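import Summits.Ventures.PercRepro.C041SeedMonotone

/-!
# THE COVER OF THE LOWER FRONTIER — the two assembly lemmas (mine-3, gen 64; C-041.md §21 (ay))

`InCone_thetaTri_v1_V_of_le`: the seed at a star from the seed at a point `(1, p₁, p₂, AB, A, B)` with `p₁ ≤ P₁`, `p₂ ≤ P₂`
(the monotonicity `InCone_thetaTri_v1_of_le` read on `V a`).  `lower_hyps`: lowering `P₂` to `min P₂ c` keeps the star bounds of
the region `H` whenever the cap `c` itself satisfies them at `(A, B, P₁)` — the bookkeeping every slab theorem needs when a
star sits above the slab's cap.
-/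

namespace PercRepro

namespace RelaxedTriangle

open TreeClosure

/-- The seed at a star `V a` from the seed at `(1, p₁, p₂, AB, A, B)` with `p₁ ≤ P₁`, `p₂ ≤ P₂`. -/
theorem InCone_thetaTri_v1_V_of_le {m : ℕ} (a : Fin m → ℝ) {p1 p2 : ℝ} (h1 : p1 ≤ ∏ i, (1 + a i ^ 2))
    (h2 : p2 ≤ ∏ i, (1 + (1 - a i) ^ 2))
    (h : InCone (thetaTri (v 1) ![1, p1, p2, (∏ i, a i) * ∏ i, (1 - a i), ∏ i, a i, ∏ i, (1 - a i)])) :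
    InCone (thetaTri (v 1) (V a)) := by
  have hc := TreeClosure.V_coords a
  have hw : V a = ![1, ∏ i, (1 + a i ^ 2), ∏ i, (1 + (1 - a i) ^ 2), (∏ i, a i) * ∏ i, (1 - a i), ∏ i, a i,
      ∏ i, (1 - a i)] := by
    ext i
    fin_cases i <;> simp [hc.1, hc.2.1, hc.2.2.1, hc.2.2.2.1, hc.2.2.2.2.1, hc.2.2.2.2.2]
  rw [hw]
  exact InCone_thetaTri_v1_of_le (w := ![1, ∏ i, (1 + a i ^ 2), ∏ i, (1 + (1 - a i) ^ 2), (∏ i, a i) * ∏ i, (1 - a i),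
    ∏ i, a i, ∏ i, (1 - a i)]) (p1 := p1) (p2 := p2) (by simpa using h1) (by simpa using h2) (by simpa using h)

/-- Lowering `P₂` to `min P₂ c` keeps the lower star bounds of `H` when the cap `c` satisfies them, and keeps `P₂² A ≤ 1`. -/
theorem lower_hyps (P1 P2 A B c : ℝ) (hA0 : 0 ≤ A) (hc0 : 0 ≤ c)
    (h2 : 1 + B ^ 2 ≤ P2) (h4B : 4 * B ≤ P2) (hR : 3 / 2 * (1 - A) ^ 2 ≤ P1 * (P2 - 1))
    (hRm : 3 / 2 * (1 - B) ^ 2 ≤ P2 * (P1 - 1)) (hU : ((1 - A) * (1 - B)) ^ 2 ≤ (P1 - 1) * (P2 - 1)) (hu2 : P2 ^ 2 * A ≤ 1)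
    (c2 : 1 + B ^ 2 ≤ c) (c4B : 4 * B ≤ c) (cR : 3 / 2 * (1 - A) ^ 2 ≤ P1 * (c - 1))
    (cRm : 3 / 2 * (1 - B) ^ 2 ≤ c * (P1 - 1)) (cU : ((1 - A) * (1 - B)) ^ 2 ≤ (P1 - 1) * (c - 1)) :
    1 + B ^ 2 ≤ min P2 c ∧ 4 * B ≤ min P2 c ∧ 3 / 2 * (1 - A) ^ 2 ≤ P1 * (min P2 c - 1)
      ∧ 3 / 2 * (1 - B) ^ 2 ≤ min P2 c * (P1 - 1) ∧ ((1 - A) * (1 - B)) ^ 2 ≤ (P1 - 1) * (min P2 c - 1)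
      ∧ (min P2 c) ^ 2 * A ≤ 1 := by
  rcases le_total P2 c with h | h
  · rw [min_eq_left h]
    exact ⟨h2, h4B, hR, hRm, hU, hu2⟩
  · rw [min_eq_right h]
    refine ⟨c2, c4B, cR, cRm, cU, ?_⟩
    have hsq : c ^ 2 ≤ P2 ^ 2 := by nlinarith
    nlinarith [mul_le_mul_of_nonneg_right hsq hA0]

end RelaxedTriangle

end PercRepro
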